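import Summits.CriticalPhenomena.PercolationContinuityZ3.Theorems.Transplant.SkelPhiCellsWeakGLevels
import Summits.CriticalPhenomena.PercolationContinuityZ3.Theorems.Transplant.TwoAxisParaCellsFineRep
import HarnessLib

/-!
# N1 ({±1} node): the SCHEME GEOMETRY OF THE FINE CELLS in one theorem — `Lip`, `RunGeom`, `AnchGeom`, `SepGeom₂`, `ExitGeom`, `StepsGeom`,
# `LevelGeom`, `QSepGeom` of `cellGeomSG₂ G ψ P t Λ` at the fine cell map `ψ = fineSkel φ t A n h vα vβ c₀ c₁ (D/2) (D/2) D` (hp-8 g33; the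
# ingredients of `GeomHoldsN(O)` for the choice function of record, to be called with stmt's `NegPrm.fine`/`Neg.fcells` and schedule)

builds on p205010 (kernel theorem, internal audit signed; external expert review pending) — nothing in this file uses p205010; nothing here is a
claim about the open node `SamePDropOfSkeletonNeg`.
Lane `prim-bschramm`, seat `prim-hp-8` (gen 33); helper file (`--supports stmt-CriticalPhenomena-4575 --as helper`).
Hypotheses: `Lip`/`Steps` of the FINE map `φ` (the node's `lip`/`step`), the resolution room `c_i·L_i + 2 ≤ D` (stmt's cells one notch below maximal),
`0 < c_i`, `D = detD … > 0`, a schedule `Λ` with `WFS2 P Λ` whose cube radius also covers the fine column point: `‖rep₂(cen x)‖₁ + 1 ≤ rQ a x` (`hcolQ`).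
* **`geom_fineSkel`** (the eight facts), and the separate projections `lip_fine'`, `weakSteps_fine'` for consumers that need only those.
[cite: KozmaNitzan2024, §4 pp. 25–31] [cite: MartineauTassion2017, §4.3]
-/

noncomputable section

open scoped Classical

namespace Summit.CriticalPhenomena.PercolationContinuityZ3.Theorems

namespace Transplant

namespace Skelφ

open Literature.Probability.Percolation Literature.Probability.LatticeModels SimpleGraph KNCells
open Literature.Probability.Percolation.KozmaNitzan
open BoxProdZ2 (ConcRadiiG)
open TwoAxis.Para (detD rep₂)

variable {V : Type} [DecidableEq V] {G : SimpleGraph V} [G.LocallyFinite] {φ : V → Site 2}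

/-- **THE SCHEME GEOMETRY OF THE FINE CELLS**: at `ψ := fineSkel φ t A n h vα vβ c₀ c₁ (D/2) (D/2) D` (`D = det`), for cells `P` and a schedule `Λ` with
`WFS2 P Λ` and cube radii covering the fine column points, the record `cellGeomSG₂ G ψ P t Λ` (root `t`) has `Lip ψ` and all of
`RunGeom/AnchGeom/SepGeom₂/ExitGeom/StepsGeom/LevelGeom/QSepGeom`. [cite: KozmaNitzan2024, §4 pp. 25–31] -/
theorem geom_fineSkel (hlip : Lip G φ) (hstep : Steps G φ) (t : V) {A n h vα vβ c₀ c₁ : ℤ} (hc₀ : 0 < c₀) (hc₁ : 0 < c₁)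
    (hD : 0 < detD A n h vα vβ) (hL0 : c₀ * (|A| * (|vβ| + |vα|)) + 2 ≤ detD A n h vα vβ)
    (hL1 : c₁ * (|A| * (|n| + |h|)) + 2 ≤ detD A n h vα vβ) (P : PCells2) {Λ : ConcRadiiG} (hΛ : WFS2 P Λ)
    (hcolQ : ∀ a x, (rep₂ A n h vα vβ c₀ c₁ (P.cen x) 0).natAbs + (rep₂ A n h vα vβ c₀ c₁ (P.cen x) 1).natAbs + 1 ≤ Λ.rQ a x) :
    let ψ := fineSkel φ t A n h vα vβ c₀ c₁ (detD A n h vα vβ / 2) (detD A n h vα vβ / 2) (detD A n h vα vβ)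
    Lip G ψ ∧ RunGeom G (cellGeomSG₂ G ψ P t Λ) ∧ AnchGeom (cellGeomSG₂ G ψ P t Λ) ∧ SepGeom₂ G (cellGeomSG₂ G ψ P t Λ) ∧
      ExitGeom G (cellGeomSG₂ G ψ P t Λ) ∧ StepsGeom (cellGeomSG₂ G ψ P t Λ) (faceDataSG G ψ P t Λ) ∧
      LevelGeom G (cellGeomSG₂ G ψ P t Λ) (faceDataSG G ψ P t Λ) (levelDataS ψ P) ∧ QSepGeom G (cellGeomSG₂ G ψ P t Λ) := by
  intro ψ
  have hlipψ : Lip G ψ := lip_fineSkel hlip t hc₀.le hc₁.le hD (by linarith) (by linarith)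
  have hws : WeakSteps G ψ := weakSteps_fineSkel hstep t hD hc₀.le hc₁.le
  have hψ0 : ψ t = 0 := by
    have hD2 : 0 ≤ detD A n h vα vβ / 2 := Int.ediv_nonneg hD.le (by norm_num)
    have hD2' : detD A n h vα vβ / 2 < detD A n h vα vβ := by omega
    have h0 : TwoAxis.Para.coarse c₀ (detD A n h vα vβ / 2) (detD A n h vα vβ) 0 = 0 := by
      unfold TwoAxis.Para.coarse; rw [mul_zero, zero_add]; exact Int.ediv_eq_zero_of_lt hD2 hD2'
    have h1 : TwoAxis.Para.coarse c₁ (detD A n h vα vβ / 2) (detD A n h vα vβ) 0 = 0 := by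
      unfold TwoAxis.Para.coarse; rw [mul_zero, zero_add]; exact Int.ediv_eq_zero_of_lt hD2 hD2'
    have hrel : relφ φ t t = 0 := by funext i; simp [relφ]
    funext i
    fin_cases i
    · show ψ t 0 = 0
      simp only [ψ, fineSkel_apply_zero, hrel]; unfold TwoAxis.Para.lam0; simp [h0]
    · show ψ t 1 = 0
      simp only [ψ, fineSkel_apply_one, hrel]; unfold TwoAxis.Para.lam1 TwoAxis.Para.bp; simp [h1]
  have hcol : ∀ a x, ∃ y ∈ VWin G ψ t (P.Q x) (Λ.rQ a x), ψ y = P.cen x := fun a x =>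
    hcol_fineSkel hlip hstep t hc₀ hc₁ hD hL0 hL1 P x (hcolQ a x)
  exact ⟨hlipψ, runGeomSG₂ P t, anchGeomSG₂ P t, sepGeom₂SG₂ P t hΛ hψ0 hlipψ hws hcol, exitGeomSG₂ P t hΛ hlipψ, stepsGeomSG₂ P t hΛ hlipψ hws,
    levelGeomSG₂ P t hΛ hlipψ, qSepGeomSG₂ P t hlipψ⟩

end Skelφ

end Transplant

end Summit.CriticalPhenomena.PercolationContinuityZ3.Theorems

end
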